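import Summits.RiemannHypothesis.RiemannHypothesis.Theorems.Splittings.LinearRayLehmerWindowDefs

/-!
# The linear-factor ray at Lehmer's pair — compiled certificate 1/3: the dip

Cell rh-split (D-0116 arm), ENGINE 5 (rh-splitx-eng-5 g4), lane (xviii-D) «LEHMER WINDOW DATA».
The dip check `ldDipRun 40000 280202480 720 219000` — grid `t_k = 7005.062 + k/40000`, `k ≤ 720`
(`t₁ = 7005.062`, `t_720 = t₀ = 7005.08`, window length `L = 2·720/40000 = 9/250` in `x = 2t`), 721
certified `ζ` evaluations of the engine (`lehmerFBox`, κ = 0), uniform Cauchy slack `4M*/B²` and the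
`10⁻⁶` representation term, against `M = 219000` (`K₀`-free units) — evaluated ONCE by `native_decide`
(a declared computational axiom `ldDip_check`, like the engine's `hiWin1_check`).  Design numbers (farm
`#eval` of the same definitions): `max_k hi Re F_0(½+it_k)/S = 192799`, slack `24637`, `10⁻⁶` term
`1260`, total `218696 ≤ 219000`; `Re F_0(½+it₁) = −18268 < 0`.  Soundness: `ldDipRunWith_sound`
(file `LinearRayLehmerWindowDip.lean`).
HONEST LABEL: RH-free negative-side bookkeeping on the linear-factor ray; nothing here bears on the truth of RH.
-/

set_option linter.dupNamespace false

namespace Summit.RiemannHypothesis.RiemannHypothesis.Theorems.Splittings.LinearRayLehmerWindow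

/-- **The compiled dip check** (721 certified `ζ` evaluations; `native_decide`). [folklore] -/
theorem ldDip_check : ldDipRun 40000 280202480 720 219000 = true := by
  native_decide

end Summit.RiemannHypothesis.RiemannHypothesis.Theorems.Splittings.LinearRayLehmerWindow
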